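import Literature.AnabelianGeometry.EtaleTheta.Discharge.Sec2Def27OrbitsOfStandardTypeModelChi
import Literature.AnabelianGeometry.EtaleTheta.SettingModelChiThetaEnv
import Literature.AnabelianGeometry.EtaleTheta.StandardEnvOfSetting
import HarnessLib

/-!
# [EtTh] Def. 2.13 (iv) «model bi-theta environment of standard type» — a NON-VACUOUS inhabitant at the Kummer-carrying
# χ-model (`p ≡ 1 (mod 4)`), for the model's own non-trivial theta class (proof-only census knit)

S. Mochizuki, *The étale theta function and its Frobenioid-theoretic manifestations*, Publ. RIMS **45** (2009) [EtTh], §2,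
Def. 2.13 (iii)/(iv), PRIMS PDF p. 48 (kurims p. 44–45): «(iv) In the situation of (iii), if `η̲̈^{Θ,l·ℤ×μ₂}` is of standard
type, then we shall refer to the resulting [mod `N`] model bi-theta environment as being of standard type»
[cite: MochizukiEtTh2009, Def 2.13 (iv) p.48]; Def. 2.7 p. 41 [cite: MochizukiEtTh2009, Def 2.7 p.41].

Cell abc-iut, layer L2, seat abc-iut-L2-t10 (gen 8), abc-iut-L2-lead menu M10 «§2 DEFS» census (R1071/R1072 standard:
a DEF row counts when the typed def matches print AND is inhabited NON-VACUOUSLY at a model of record).  The typed Def. 2.13 (iv),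
abc-iut-L2-t8's `MuTwoSetting.IsModelBiOfStandardType C μ hC hS εZ S B := (∃ η hη, B = (C.thetaEnvData μ hC hS).modelBi hη) ∧
OrbitsOfStandardType C hC εZ S` (`StandardEnvOfSetting`), was so far inhabited only VACUOUSLY (abc-iut-L2-t7's
`SettingModel.model_forall_isModelBiOfStandardType`: the root model carries no étale-theta datum).  Its two conjuncts are each
theorems at ONE datum of record — the χ-twisted model `modelχ` with `p ≡ 1 (mod 4)`: the §1 → §2 adapter `C.thetaEnvData`
(abc-iut-L2-t8; the datum `etaleThetaDataχSec p (etaDdχ p)`, `doubleUnderlineχSec`, `modelχ_nonempty_cyclotomeMod`,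
`modelχ_sec2Hyps` of `SettingModelChiThetaEnv`, abc-iut-L2-d1/L2-t2) has a non-empty collection of theta cocycles (the
interface clause `thetaCocycles_nonempty`), and abc-iut-f-132's `orbitsOfStandardType_etaDdχ` (p461839) gives Def. 2.7 for the
model's OWN class `etaDdχ p ≠ 1` at EVERY `X̲̲` over that datum.  This file knits them:
* **`exists_isModelBiOfStandardType_modelχ`** — for `p ≡ 1 (mod 4)`, every odd `l`, every level `N` and every `Compat`
  witness: THERE EXIST `X̲̲`, a cyclotome identification `μ`, a Def. 1.9 datum `S` and a bi-theta environment `B` with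
  `IsModelBiOfStandardType … B` — Def. 2.13 (iv) INHABITED non-vacuously (and `η̈^Θ ≠ 1`).
PROOF-ONLY (0 definitions); inputs BY NAME; nothing restated.  HONEST FRAMING: semi-synthetic model (consistency evidence for the
typed interface); nothing of [EtTh] asserted; no side taken on [IUTchIII] Cor. 3.12; typed ≠ proved; instantiated ≠ endorsed.
-/

noncomputable section

namespace Literature.AnabelianGeometry.EtaleTheta.SettingModel

open ThetaSetting

variable (p : ℕ) [Fact p.Prime]

/-- **[EtTh] Def. 2.13 (iv) is INHABITED NON-VACUOUSLY at `modelχ` (`p ≡ 1 (mod 4)`)**: for every odd `l`, level `N` and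
`Compat` witness there are a choice `X̲̲` (`doubleUnderlineχSec`), a cyclotome identification `μ`, a Def. 1.9 datum `S` (Galois-section
points labelled `√−1^{±1}`, abc-iut-f-132) and a bi-theta environment `B` — THE model bi-theta environment of a theta cocycle of the
§1 → §2 adapter — such that `B` is a model bi-theta environment OF STANDARD TYPE in the typed sense; the theta class is the
model's own `etaDdχ p ≠ 1`. [cite: MochizukiEtTh2009, Def 2.13 (iv) p.48] -/
theorem exists_isModelBiOfStandardType_modelχ (hp : p % 4 = 1) (l : ℕ+) (hl : Odd (l : ℕ)) (N : ℕ+)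
    (hC : (ThetaSetting.modelχ p).Compat) :
    ∃ (C : (etaleThetaDataχSec p (etaDdχ p)).DoubleUnderline l) (μ : (ThetaSetting.modelχ p).CyclotomeMod l N)
      (S : (MuTwoSetting.modelχ p).StandardData (kummerDataχSec p)) (B : BiThetaEnv.{0}),
      (etaleThetaDataχSec p (etaDdχ p)).etaDd ≠ 1 ∧
        MuTwoSetting.IsModelBiOfStandardType (M := MuTwoSetting.modelχ p) C μ hC (ThetaSetting.modelχ_sec2Hyps p)
          (epsZχ p) S B := by
  obtain ⟨μ⟩ := modelχ_nonempty_cyclotomeMod p l.pos N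
  obtain ⟨S, -, -, -, hS⟩ := orbitsOfStandardType_etaDdχ p hp
  obtain ⟨η, hη⟩ := ((doubleUnderlineχSec p l hl).thetaEnvData μ hC (ThetaSetting.modelχ_sec2Hyps p)).thetaCocycles_nonempty
  exact ⟨doubleUnderlineχSec p l hl, μ, S, _, etaDdχ_ne_one p, ⟨η, hη, rfl⟩, hS hC l _⟩

end Literature.AnabelianGeometry.EtaleTheta.SettingModel

end
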